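import Literature.AlgebraicGeometry.Resolution.InseparableLocalUniformizationLemmas
import Mathlib.RingTheory.Localization.Integral
import Mathlib.RingTheory.Algebraic.Integral
import HarnessLib

/-!
# Fractions and normality of the normalization `Nr_{L₁}(A′)`

Topic: `Literature/AlgebraicGeometry/Resolution` (valued function fields; models over valuation
rings). Bookkeeping for the algebraization step of M. Temkin, *Inseparable local uniformization*,
J. Algebra 373 (2013) = arXiv:0804.1554v3, Thm. 3.3.1 (tree: `Temkin2013RelativeCurveSmoothFibre`),
whose conclusion concerns `N = Nr_{L₁}(A′)`, the integral closure in a finite extension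
`L₁ ⊇ K` of an affine normalized model `A′ ⊆ K` with `Frac A′ = K` (Temkin, §2.3 and §3.3):
`Frac N = L₁`, and `N` is an integrally closed domain (so that the étale charts over its
localizations are normal, `EtaleChartNormal.lean`).

* `isFractionRing_of_forall_exists_div` — a subring of a field all of whose elements are
  quotients is a fraction ring presentation — PROVED;
* `exists_div_nrIn` — every `z ∈ L₁` is `a / b` with `a, b ∈ Nr_{L₁}(A′)`, `b ≠ 0` (indeed
  `b ∈ A′`) — PROVED;
* `isIntegrallyClosed_nrIn` — `Nr_L(T)` is integrally closed once `Frac Nr_L(T) = L` — PROVED.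

All statements are [folklore]; no definitions, no named facts.

## Sources

* M. Temkin, arXiv:0804.1554v3, §2.3 (normalizations `Nr`), §3.3 (affine normalized models).
-/

noncomputable section

namespace Literature.AlgebraicGeometry.Resolution

universe u

section Frac

variable {L : Type u} [Field L]

/-- **A subring of quotients presents the field as its fraction field.** [folklore] -/
theorem isFractionRing_of_forall_exists_div (S : Subring L)
    (h : ∀ z : L, ∃ a ∈ S, ∃ b ∈ S, z = a / b) : IsFractionRing S L := by
  refine ⟨?_, fun z => ?_, fun {x y} hxy => ⟨1, ?_⟩⟩
  · rintro ⟨y, hy⟩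
    have hy0 : (y : L) ≠ 0 := fun h0 =>
      nonZeroDivisors.ne_zero hy (Subtype.ext h0)
    exact isUnit_iff_ne_zero.mpr hy0
  · obtain ⟨a, ha, b, hb, rfl⟩ := h z
    by_cases hb0 : b = 0
    · refine ⟨(0, 1), ?_⟩
      simp [hb0]
    · refine ⟨(⟨a, ha⟩, ⟨⟨b, hb⟩, mem_nonZeroDivisors_of_ne_zero fun h0 => hb0 ?_⟩), ?_⟩
      · exact congrArg Subtype.val h0
      · change a / b * b = a
        rw [div_mul_cancel₀ a hb0]
  · have : x = y := Subtype.ext hxy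
    rw [this]

/-- **`Nr_L(T)` is integrally closed** when `L` is its field of fractions. [folklore] -/
theorem isIntegrallyClosed_nrIn (T : Subring L)
    (h : ∀ z : L, ∃ a ∈ nrIn T, ∃ b ∈ nrIn T, z = a / b) : IsIntegrallyClosed (nrIn T) := by
  haveI := isFractionRing_of_forall_exists_div (nrIn T) h
  rw [isIntegrallyClosed_iff L]
  intro z hz
  have hz' : z ∈ nrIn (nrIn T) := mem_nrIn_iff.mpr hz
  rw [nrIn_nrIn] at hz'
  exact ⟨⟨z, hz'⟩, rfl⟩

end Frac

section Finite

variable {K L₁ : Type u} [Field K] [Field L₁] [Algebra K L₁]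

/-- **Fractions in the normalization of a finite extension**: if `Frac A′ = K` and `L₁|K` is
finite, every `z ∈ L₁` is `a / b` with `a ∈ Nr_{L₁}(A′)` and `0 ≠ b ∈ A′ ⊆ Nr_{L₁}(A′)`.
[folklore] -/
theorem exists_div_nrIn [FiniteDimensional K L₁] (A' : Subring K)
    (hfr : ∀ w : K, ∃ a ∈ A', ∃ b ∈ A', w = a / b) (z : L₁) :
    ∃ a ∈ nrIn (A'.map (algebraMap K L₁)), ∃ b ∈ nrIn (A'.map (algebraMap K L₁)),
      b ≠ 0 ∧ z = a / b := by
  haveI : IsFractionRing A' K := isFractionRing_of_forall_exists_div A' hfr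
  letI : Algebra A' L₁ := ((algebraMap K L₁).comp A'.subtype).toAlgebra
  haveI : IsScalarTower A' K L₁ := IsScalarTower.of_algebraMap_eq fun _ => rfl
  have hzK : IsAlgebraic K z := Algebra.IsAlgebraic.isAlgebraic z
  have hzA : IsAlgebraic A' z := (IsFractionRing.isAlgebraic_iff A' K L₁).mpr hzK
  obtain ⟨y, hy0, hint⟩ := hzA.exists_integral_multiple
  -- the image subring `A′ ↦ L₁` and integrality over it
  set φ := algebraMap K L₁ with hφ
  let ψ : A' →+* A'.map φ :=
    { toFun := fun c => ⟨φ c, Subring.mem_map.mpr ⟨c, c.2, rfl⟩⟩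
      map_one' := Subtype.ext (by simp)
      map_mul' := fun _ _ => Subtype.ext (by simp)
      map_zero' := Subtype.ext (by simp)
      map_add' := fun _ _ => Subtype.ext (by simp) }
  have hψ : ∀ c : A', ((ψ c : A'.map φ) : L₁) = algebraMap A' L₁ c := fun _ => rfl
  have hint' : IsIntegral (A'.map φ) (y • z) := by
    obtain ⟨p, hpm, hp⟩ := hint
    refine ⟨p.map ψ, hpm.map ψ, ?_⟩
    rw [Polynomial.eval₂_map]
    have : (algebraMap (A'.map φ) L₁).comp ψ = algebraMap A' L₁ := RingHom.ext fun c => hψ c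
    rw [this]
    exact hp
  refine ⟨y • z, mem_nrIn_iff.mpr hint', algebraMap A' L₁ y,
    le_nrIn _ (Subring.mem_map.mpr ⟨y, y.2, rfl⟩), ?_, ?_⟩
  · change φ (y : K) ≠ 0
    exact (map_ne_zero φ).mpr fun h0 => hy0 (Subtype.ext h0)
  · have hy' : algebraMap A' L₁ y ≠ 0 := by
      change φ (y : K) ≠ 0
      exact (map_ne_zero φ).mpr fun h0 => hy0 (Subtype.ext h0)
    rw [Algebra.smul_def, mul_comm, mul_div_assoc, div_self hy', mul_one]

end Finite

end Literature.AlgebraicGeometry.Resolution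

end
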